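import Summits.CriticalPhenomena.PercolationContinuityZ3.Theorems.PercNearOneGluingNoHeavyLowerTailSahiCombCellTwoTwoKit

/-!
# `TRI_W ≥ 0` on the cells `(c,2,2)` of the triangle class — ATOMS on the index cube, the certificate CHECKER, and the generic theorem

Support file of the one-cut programme (crux `NoHeavyLowerTail`, stmt-CriticalPhenomena-4575; lemma factory `prim-lf-1`, gen 28); continuation of
`…SahiCombCellTwoTwoKit` (codes, the bridge `2·triW = Σ_z tsym`, the covering of up-sets of `W = 2^4` by byte masks).

Here: the 36-element poset `M = Up(X) × Up(Y)` on codes `c = 6u + v`, pull-backs `pull gc hc S = {z : code z ∈ S}` of its up-sets along the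
(monotone) code map of two monotone cylinder families — these are up-sets of the index cube `Finset ζ` (`isUpperSet_pull`) — and the two
ATOM shapes of the certificates with their non-negativity summed over the index cube: the Kleitman atom `iKL` (`sum_iKL_nonneg`, from
`card_inter_refl_le`) and the five-up-set atom `iPHI` (`sum_iPHI_nonneg`, from `fiveUpSetIneq_holds`).  A certificate is a list of `Atom`s
(multiplicity, kind, five 36-bit masks); `check n₀ n₁ D L` verifies the side conditions and the pointwise domination
`certVal L (code z, code zᶜ) ≤ D · tsym` at all `6⁴` code pairs; **`triW_nonneg_of_check`**: a passed check for the masks `(n₀,n₁)` of `P`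
gives `0 ≤ triW P F G` for every index cube and all monotone families of `X`- and `Y`-cylinders.
HONEST LABEL: infrastructure (definitions + generic lemmas); the 168 certificates are in `…SahiCombCellTwoTwoCertA/B/C/D`, the theorem in
`…SahiCombCellTwoTwo`. [this work]
-/

namespace Summit.CriticalPhenomena.PercolationContinuityZ3.Theorems

namespace FiveUpSet

namespace Cell22

open Finset

variable {ζ : Type} [DecidableEq ζ] [Fintype ζ]

/-! ### The poset `M = Up(X) × Up(Y)` on codes `c = 6u + v`, pulled-back up-sets of the index cube, and the atoms -/

/-- The product order on `M`-codes. [this work] -/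
def leM (c d : ℕ) : Bool := le6 (c / 6) (d / 6) && le6 (c % 6) (d % 6)

/-- `S` (a 36-bit mask) is an up-set of `M`. [this work] -/
def upM (S : ℕ) : Bool := decide (∀ c d : Fin 36, leM c d = true → S.testBit c = true → S.testBit d = true)

/-- Bitwise inclusion of 36-bit masks. [this work] -/
def sub36 (S T : ℕ) : Bool := decide (∀ c : Fin 36, S.testBit c = true → T.testBit c = true)

/-- The `M`-code of an index point. [this work] -/
def code (gc hc : Finset ζ → Fin 6) (z : Finset ζ) : ℕ := 6 * (gc z : ℕ) + (hc z : ℕ)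

omit [DecidableEq ζ] [Fintype ζ] in
/-- Codes are `< 36`. [this work] -/
theorem code_lt (gc hc : Finset ζ → Fin 6) (z : Finset ζ) : code gc hc z < 36 := by
  unfold code; have := (gc z).isLt; have := (hc z).isLt; omega

omit [DecidableEq ζ] [Fintype ζ] in
/-- Division and remainder of a code. [this work] -/
theorem code_div_mod (gc hc : Finset ζ → Fin 6) (z : Finset ζ) :
    code gc hc z / 6 = (gc z : ℕ) ∧ code gc hc z % 6 = (hc z : ℕ) := by
  unfold code; have := (hc z).isLt; constructor <;> omega

omit [DecidableEq ζ] [Fintype ζ] in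
/-- Monotone cylinder families have monotone codes. [this work] -/
theorem leM_code (F G : Finset ζ → Finset (Finset (Fin 4))) (gc hc : Finset ζ → Fin 6)
    (hF : ∀ z, F z = cylX (gc z)) (hG : ∀ z, G z = cylY (hc z)) (hFm : Monotone F) (hGm : Monotone G)
    {z z' : Finset ζ} (h : z ⊆ z') : leM (code gc hc z) (code gc hc z') = true := by
  have h1 : le6 (gc z) (gc z') = true := by
    apply le6_of_cylX_subset; rw [← hF z, ← hF z']; exact hFm h
  have h2 : le6 (hc z) (hc z') = true := by
    apply le6_of_cylY_subset; rw [← hG z, ← hG z']; exact hGm h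
  unfold leM
  rw [(code_div_mod gc hc z).1, (code_div_mod gc hc z).2, (code_div_mod gc hc z').1, (code_div_mod gc hc z').2, h1, h2]
  rfl

/-- The pull-back of the `M`-set `S` along the code map. [this work] -/
def pull (gc hc : Finset ζ → Fin 6) (S : ℕ) : Finset (Finset ζ) := univ.filter fun z => S.testBit (code gc hc z) = true

omit [DecidableEq ζ] in
/-- Membership in a pull-back. [this work] -/
theorem mem_pull {gc hc : Finset ζ → Fin 6} {S : ℕ} {z : Finset ζ} : z ∈ pull gc hc S ↔ S.testBit (code gc hc z) = true := by
  simp [pull]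

/-- Membership in the antipodal image of a pull-back. [this work] -/
theorem mem_refl_pull {gc hc : Finset ζ → Fin 6} {S : ℕ} {z : Finset ζ} :
    z ∈ refl (pull gc hc S) ↔ S.testBit (code gc hc zᶜ) = true := by
  rw [mem_refl, mem_pull]

omit [DecidableEq ζ] in
/-- Pull-backs of up-sets of `M` along monotone codes are up-sets of the index cube. [this work] -/
theorem isUpperSet_pull {gc hc : Finset ζ → Fin 6} (hmono : ∀ z z' : Finset ζ, z ⊆ z' → leM (code gc hc z) (code gc hc z') = true)
    {S : ℕ} (hS : upM S = true) : IsUpperSet (pull gc hc S : Set (Finset ζ)) := by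
  have key := of_decide_eq_true hS
  intro z z' hzz' hz
  rw [mem_coe, mem_pull] at hz ⊢
  exact key ⟨_, code_lt gc hc z⟩ ⟨_, code_lt gc hc z'⟩ (hmono z z' hzz') hz

omit [DecidableEq ζ] in
/-- Bitwise inclusion gives inclusion of pull-backs. [this work] -/
theorem pull_subset_pull {gc hc : Finset ζ → Fin 6} {S T : ℕ} (h : sub36 S T = true) : pull gc hc S ⊆ pull gc hc T := by
  have key := of_decide_eq_true h
  intro z hz
  rw [mem_pull] at hz ⊢
  exact key ⟨_, code_lt gc hc z⟩ hz

/-- Cardinality of a family of index points as a sum of an indicator over the whole index cube. [this work] -/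
theorem card_eq_sum_ite (A : Finset (Finset ζ)) : (A.card : ℤ) = ∑ z : Finset ζ, (if z ∈ A then (1 : ℤ) else 0) := by
  rw [Finset.sum_ite_mem, univ_inter, Finset.sum_const]
  simp

/-- The Kleitman atom: integrand of `#(S ∩ T) − #(S ∩ refl T)` for pulled-back `S, T` at codes `(c, c') = (code z, code zᶜ)`. [this work] -/
def iKL (S T c c' : ℕ) : ℤ := b2z (S.testBit c && T.testBit c) - b2z (S.testBit c && T.testBit c')

/-- The five-up-set atom: integrand of the five-up-set slack for pulled-back `C; A₀ ⊆ A₁; B₀ ⊆ B₁` at codes `(c, c')`. [this work] -/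
def iPHI (C A₀ A₁ B₀ B₁ c c' : ℕ) : ℤ :=
  b2z (C.testBit c && A₁.testBit c && B₁.testBit c) + b2z (C.testBit c && A₀.testBit c && B₀.testBit c)
    - b2z (C.testBit c && A₁.testBit c && B₀.testBit c') - b2z (C.testBit c && A₀.testBit c' && B₁.testBit c)
    - b2z (C.testBit c && (A₁.testBit c' && !A₀.testBit c') && (B₁.testBit c' && !B₀.testBit c'))

/-- **Kleitman atom ≥ 0**: summed over the index cube the Kleitman integrand is `#(S∩T) − #(S ∩ refl T) ≥ 0` (`card_inter_refl_le`). [this work] -/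
theorem sum_iKL_nonneg {gc hc : Finset ζ → Fin 6} (hmono : ∀ z z' : Finset ζ, z ⊆ z' → leM (code gc hc z) (code gc hc z') = true)
    {S T : ℕ} (hS : upM S = true) (hT : upM T = true) :
    0 ≤ ∑ z : Finset ζ, iKL S T (code gc hc z) (code gc hc zᶜ) := by
  have h := card_inter_refl_le (U := pull gc hc S) (X := pull gc hc T) (isUpperSet_pull hmono hS) (isUpperSet_pull hmono hT)
  have e1 : pull gc hc S ∩ pull gc hc T = univ.filter (fun z => (S.testBit (code gc hc z) && T.testBit (code gc hc z)) = true) := by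
    ext z; simp [pull]
  have e2 : pull gc hc S ∩ refl (pull gc hc T)
      = univ.filter (fun z => (S.testBit (code gc hc z) && T.testBit (code gc hc zᶜ)) = true) := by
    ext z; simp [pull, mem_refl]
  rw [e1, e2] at h
  have h' := (Nat.cast_le (α := ℤ)).2 h
  rw [natCast_card_filter, natCast_card_filter] at h'
  have hid : ∑ z : Finset ζ, iKL S T (code gc hc z) (code gc hc zᶜ)
      = ∑ z : Finset ζ, (if (S.testBit (code gc hc z) && T.testBit (code gc hc z)) = true then (1 : ℤ) else 0)
        - ∑ z : Finset ζ, (if (S.testBit (code gc hc z) && T.testBit (code gc hc zᶜ)) = true then (1 : ℤ) else 0) := by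
    rw [← Finset.sum_sub_distrib]
    rfl
  rw [hid]
  linarith

/-- **Five-up-set atom ≥ 0**: summed over the index cube the five-up-set integrand is the slack of `fiveUpSetIneq_holds`
for the pulled-back up-sets `pull C; pull A₀ ⊆ pull A₁; pull B₀ ⊆ pull B₁`. [this work] -/
theorem sum_iPHI_nonneg {gc hc : Finset ζ → Fin 6} (hmono : ∀ z z' : Finset ζ, z ⊆ z' → leM (code gc hc z) (code gc hc z') = true)
    {C A₀ A₁ B₀ B₁ : ℕ} (hC : upM C = true) (hA₀ : upM A₀ = true) (hA₁ : upM A₁ = true) (hB₀ : upM B₀ = true)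
    (hB₁ : upM B₁ = true) (hA : sub36 A₀ A₁ = true) (hB : sub36 B₀ B₁ = true) :
    0 ≤ ∑ z : Finset ζ, iPHI C A₀ A₁ B₀ B₁ (code gc hc z) (code gc hc zᶜ) := by
  have h := fiveUpSetIneq_holds ζ (pull gc hc C) (pull gc hc A₀) (pull gc hc A₁) (pull gc hc B₀) (pull gc hc B₁)
    (isUpperSet_pull hmono hC) (isUpperSet_pull hmono hA₀) (isUpperSet_pull hmono hA₁) (isUpperSet_pull hmono hB₀)
    (isUpperSet_pull hmono hB₁) (pull_subset_pull hA) (pull_subset_pull hB)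
  have e1 : pull gc hc C ∩ pull gc hc A₁ ∩ refl (pull gc hc B₀)
      = univ.filter (fun z => (C.testBit (code gc hc z) && A₁.testBit (code gc hc z) && B₀.testBit (code gc hc zᶜ)) = true) := by
    ext z; simp [pull, mem_refl, and_assoc]
  have e2 : pull gc hc C ∩ refl (pull gc hc A₀) ∩ pull gc hc B₁
      = univ.filter (fun z => (C.testBit (code gc hc z) && A₀.testBit (code gc hc zᶜ) && B₁.testBit (code gc hc z)) = true) := by
    ext z; simp [pull, mem_refl, and_assoc]
  have e3 : pull gc hc C ∩ refl (pull gc hc A₁ \ pull gc hc A₀) ∩ refl (pull gc hc B₁ \ pull gc hc B₀)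
      = univ.filter (fun z => (C.testBit (code gc hc z) && (A₁.testBit (code gc hc zᶜ) && !A₀.testBit (code gc hc zᶜ))
          && (B₁.testBit (code gc hc zᶜ) && !B₀.testBit (code gc hc zᶜ))) = true) := by
    ext z; simp [pull, mem_refl, and_assoc]
  have e4 : pull gc hc C ∩ pull gc hc A₁ ∩ pull gc hc B₁
      = univ.filter (fun z => (C.testBit (code gc hc z) && A₁.testBit (code gc hc z) && B₁.testBit (code gc hc z)) = true) := by
    ext z; simp [pull, and_assoc]
  have e5 : pull gc hc C ∩ pull gc hc A₀ ∩ pull gc hc B₀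
      = univ.filter (fun z => (C.testBit (code gc hc z) && A₀.testBit (code gc hc z) && B₀.testBit (code gc hc z)) = true) := by
    ext z; simp [pull, and_assoc]
  rw [e1, e2, e3, e4, e5] at h
  have h' := (Nat.cast_le (α := ℤ)).2 h
  simp only [Nat.cast_add] at h'
  rw [natCast_card_filter, natCast_card_filter, natCast_card_filter, natCast_card_filter, natCast_card_filter] at h'
  have hid : ∑ z : Finset ζ, iPHI C A₀ A₁ B₀ B₁ (code gc hc z) (code gc hc zᶜ)
      = ∑ z : Finset ζ, (if (C.testBit (code gc hc z) && A₁.testBit (code gc hc z) && B₁.testBit (code gc hc z)) = true then (1 : ℤ) else 0)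
        + ∑ z : Finset ζ, (if (C.testBit (code gc hc z) && A₀.testBit (code gc hc z) && B₀.testBit (code gc hc z)) = true then (1 : ℤ) else 0)
        - ∑ z : Finset ζ, (if (C.testBit (code gc hc z) && A₁.testBit (code gc hc z) && B₀.testBit (code gc hc zᶜ)) = true then (1 : ℤ) else 0)
        - ∑ z : Finset ζ, (if (C.testBit (code gc hc z) && A₀.testBit (code gc hc zᶜ) && B₁.testBit (code gc hc z)) = true then (1 : ℤ) else 0)
        - ∑ z : Finset ζ, (if (C.testBit (code gc hc z) && (A₁.testBit (code gc hc zᶜ) && !A₀.testBit (code gc hc zᶜ))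
            && (B₁.testBit (code gc hc zᶜ) && !B₀.testBit (code gc hc zᶜ))) = true then (1 : ℤ) else 0) := by
    rw [← Finset.sum_add_distrib, ← Finset.sum_sub_distrib, ← Finset.sum_sub_distrib, ← Finset.sum_sub_distrib]
    rfl
  rw [hid]
  linarith

/-! ### Certificates and the checker -/

/-- An atom of a certificate: multiplicity `n`; `kind = 0`: Kleitman `(s₁,s₂) = (S,T)`; otherwise five-up-set
`(s₁,…,s₅) = (C,A₀,A₁,B₀,B₁)` (36-bit masks of up-sets of `M`). [this work] -/
structure Atom where
  /-- multiplicity -/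
  n : ℕ
  /-- `0` = Kleitman, otherwise five-up-set -/
  kind : ℕ
  /-- first set -/
  s₁ : ℕ
  /-- second set -/
  s₂ : ℕ
  /-- third set -/
  s₃ : ℕ
  /-- fourth set -/
  s₄ : ℕ
  /-- fifth set -/
  s₅ : ℕ

/-- The integrand of an atom. [this work] -/
def Atom.iota (a : Atom) (c c' : ℕ) : ℤ :=
  if a.kind = 0 then iKL a.s₁ a.s₂ c c' else iPHI a.s₁ a.s₂ a.s₃ a.s₄ a.s₅ c c'

/-- Side conditions of an atom (up-sets of `M`, nestedness). [this work] -/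
def Atom.ok (a : Atom) : Bool :=
  if a.kind = 0 then upM a.s₁ && upM a.s₂
  else upM a.s₁ && upM a.s₂ && upM a.s₃ && upM a.s₄ && upM a.s₅ && sub36 a.s₂ a.s₃ && sub36 a.s₄ a.s₅

/-- The symmetrised value of a certificate at a pair of codes. [this work] -/
def certVal (L : List Atom) (c c' : ℕ) : ℤ := (L.map fun a => (a.n : ℤ) * (a.iota c c' + a.iota c' c)).sum

/-- **The checker**: all atoms are admissible and `certVal ≤ D · tsym` at every pair of codes. [this work] -/
def check (n₀ n₁ D : ℕ) (L : List Atom) : Bool :=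
  L.all Atom.ok &&
    decide (∀ u v u' v' : Fin 6, certVal L (6 * u + v) (6 * u' + v') ≤ (D : ℤ) * tsym n₀ n₁ u v u' v')

/-- An admissible atom sums to a non-negative number over the index cube. [this work] -/
theorem sum_iota_nonneg {gc hc : Finset ζ → Fin 6} (hmono : ∀ z z' : Finset ζ, z ⊆ z' → leM (code gc hc z) (code gc hc z') = true)
    (a : Atom) (ha : a.ok = true) : 0 ≤ ∑ z : Finset ζ, a.iota (code gc hc z) (code gc hc zᶜ) := by
  unfold Atom.ok at ha
  unfold Atom.iota
  by_cases hk : a.kind = 0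
  · simp only [hk, ↓reduceIte, Bool.and_eq_true] at ha ⊢
    exact sum_iKL_nonneg hmono ha.1 ha.2
  · simp only [hk, ↓reduceIte, Bool.and_eq_true] at ha ⊢
    obtain ⟨⟨⟨⟨⟨⟨h1, h2⟩, h3⟩, h4⟩, h5⟩, h6⟩, h7⟩ := ha
    exact sum_iPHI_nonneg hmono h1 h2 h3 h4 h5 h6 h7

/-- The symmetrised certificate value sums to a non-negative number over the index cube. [this work] -/
theorem sum_certVal_nonneg {gc hc : Finset ζ → Fin 6} (hmono : ∀ z z' : Finset ζ, z ⊆ z' → leM (code gc hc z) (code gc hc z') = true)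
    (L : List Atom) (hL : L.all Atom.ok = true) : 0 ≤ ∑ z : Finset ζ, certVal L (code gc hc z) (code gc hc zᶜ) := by
  induction L with
  | nil => simp [certVal]
  | cons a L ih =>
    rw [List.all_cons, Bool.and_eq_true] at hL
    have hcons : ∀ c c', certVal (a :: L) c c' = (a.n : ℤ) * (a.iota c c' + a.iota c' c) + certVal L c c' := by
      intro c c'; simp [certVal]
    simp only [hcons, Finset.sum_add_distrib]
    have h1 : 0 ≤ ∑ z : Finset ζ, (a.n : ℤ) * (a.iota (code gc hc z) (code gc hc zᶜ) + a.iota (code gc hc zᶜ) (code gc hc z)) := by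
      rw [← Finset.mul_sum, Finset.sum_add_distrib]
      have hre : ∑ z : Finset ζ, a.iota (code gc hc zᶜ) (code gc hc z) = ∑ z : Finset ζ, a.iota (code gc hc z) (code gc hc zᶜ) :=
        Fintype.sum_equiv (complEquiv ζ) _ _ (fun z => by simp [complEquiv])
      rw [hre]
      have := sum_iota_nonneg hmono a hL.1
      positivity
    have h2 := ih hL.2
    linarith

/-- **THE GENERIC CERTIFICATE THEOREM.**  If the checker accepts `(n₀, n₁, D, L)` with `D > 0`, then for every index cube `Finset ζ`,
every up-set `P ⊆ Finset (Fin 4)` whose mask is `(n₀, n₁)` and all monotone families `F` of `X`-cylinders and `G` of `Y`-cylinders,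
`0 ≤ triW P F G`.  Proof: `2D·triW = Σ_z D·tsym ≥ Σ_z certVal = Σ_atoms n·(2·slack) ≥ 0`. [this work] -/
theorem triW_nonneg_of_check {n₀ n₁ D : ℕ} {L : List Atom} (hchk : check n₀ n₁ D L = true) (hD : 0 < D)
    (P : Finset (Finset (Fin 4))) (F G : Finset ζ → Finset (Finset (Fin 4))) (gc hc : Finset ζ → Fin 6)
    (hP : ∀ t < 16, (pmask n₀ n₁ t = true ↔ dec t ∈ P))
    (hF : ∀ z, F z = cylX (gc z)) (hG : ∀ z, G z = cylY (hc z)) (hFm : Monotone F) (hGm : Monotone G) :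
    0 ≤ triW P F G := by
  unfold check at hchk
  rw [Bool.and_eq_true] at hchk
  have hok := hchk.1
  have hpt := of_decide_eq_true hchk.2
  have hmono : ∀ z z' : Finset ζ, z ⊆ z' → leM (code gc hc z) (code gc hc z') = true :=
    fun z z' h => leM_code F G gc hc hF hG hFm hGm h
  have h2 := two_mul_triW_eq_sum_tsym P F G gc hc hF hG n₀ n₁ hP
  have hdom : ∑ z : Finset ζ, certVal L (code gc hc z) (code gc hc zᶜ)
      ≤ ∑ z : Finset ζ, (D : ℤ) * tsym n₀ n₁ (gc z) (hc z) (gc zᶜ) (hc zᶜ) := by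
    refine Finset.sum_le_sum fun z _ => ?_
    have := hpt (gc z) (hc z) (gc zᶜ) (hc zᶜ)
    simpa [code] using this
  have hnn := sum_certVal_nonneg hmono L hok
  rw [← Finset.mul_sum, ← h2] at hdom
  have hD' : (0 : ℤ) < D := by exact_mod_cast hD
  nlinarith

end Cell22

end FiveUpSet

end Summit.CriticalPhenomena.PercolationContinuityZ3.Theorems
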